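import Mathlib
import HarnessLib
import HarnessLib.Audit
import Summits.FinalStateConjecture.Statement
import Literature.Geometry.Lorentzian.RadiatedEnergy

/-!
Route: PenroseDeficitNorm

DORMANT since 2026-09-04T16:54:25Z (reconciler: no traction for 5 d (last activity statement-checked at 2026-08-30T15:54:01Z); parked, not closed — `ledger route dormant route-FinalStateConjecture-PenroseDeficitNorm --off` to reactivate) — unstaffed, not closed; items shared with open routes are served there. `ledger route dormant <id> --off` reactivates.

# Route PenroseDeficitNorm — the final Penrose deficit is a cone norm — M_B(∞) = M_irr(∞) decides
Schwarzschild; Kerr needs a saturating null mass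

It suffices to show X = E ∧ R ∧ H ∧ S, cut along ONE typed dichotomy; S = MGHDExists is the
Statement's own anti-vacuity conjunct (the summit's shared item stmt-9937: known in print, unproved
in tree), badged support at open and RE-BADGED CRUX (last-ranked) 2026-08-16 because the deciding
theorem may assume crux items only. Call a maximal development
with complete 𝓘⁺ FINALLY PENROSE-SATURATED if some canonical future Bondi foliation 𝓕
(RadiatedEnergy.BondiFoliation: cones
C_u = ∂J⁺(ι(B u)), Hawking masses of their cuts, Bondi mass M_B(u) = lim_s m_H) has (i) Hawking mass
non-decreasing outward along
every late cone, (ii) inner cuts S_u = sec u 0 whose areas converge to A_∞ > 0 and whose Hawking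
masses converge to √(A_∞/16π)
(saturating = horizon-hugging cuts, θ_L θ_L̲ → 0 in mean), and (iii) final Bondi mass EQUAL to
√(A_∞/16π). E (GainFreeConesSettle,
card penrose-deficit-is-a-norm K1+K2, equality case): a censored black-hole development which is
finally Penrose-saturated settles, C² and exhaustively — since the summit re-type T2 (2026-08-16)
with honest growing near-zone radii, future-oriented chart time and every future-complete null ray
from the data inside the closure of the settled region — to ONE Schwarzschild hole of mass M_B(∞). R
(UnsaturatedSectorSettles, imported): TAME-Christodoulou-generically (re-type T2: witness families
on one fixed end)
𝓘⁺ is complete and the UNSATURATED black-hole sector (rotating or several holes) settles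
sub-extremally — the parent node that the
card's missing object K3 (KerrSaturatingConeMass, filed informally at rank 3) is meant to split. H
(CensoredHorizonlessDisperseT2,
shared with route BondiDrainDispersal): censored horizonless developments disperse (T2 conclusion, N
= 0).
Lean: `GainFreeConesSettle ∧ UnsaturatedSectorSettles ∧ CensoredHorizonlessDisperseT2 ∧ MGHDExists`

## Assembly
Pure logic (sorry-free, theorem `closes`, re-elaborated 2026-08-16 after the re-type T2; axioms
propext / Classical.choice / Quot.sound): tame Christodoulou codimension is
antitone in the exceptional set (the witnessing end, family, tameness and immersion are kept), so it
suffices that the generic property of UnsaturatedSectorSettles implies the Statement's property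
pointwise on the admissible class: the crux S = MGHDExists gives the MGHD (the Statement's
∃-conjunct); for each MGHD, R gives complete 𝓘⁺; by excluded middle either there is no
event horizon (H gives an N = 0 exhaustive decomposition, sub-extremality vacuous over Fin 0), or
there is one and the development is
finally Penrose-saturated (E gives the Schwarzschild decomposition, sub-extremal by its own first
conjunct), or it is not (R's clause); each branch delivers the T2 clauses RaysStayInClosure /
HasExhaustiveCharts / IsFutureOriented itself. CRUX-ONLY: all four hypotheses of `closes` (E, R, H,
S) are crux items of this route; the supports ChristodoulouRuffiniIdentity / FinalPenroseInequality
and the crux PenroseConesExist (anti-vacuity of the dichotomy) are deliberately not hypotheses.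
STANDING CAVEAT: E's saturation predicate (i)–(iii) is, as typed over FutureBondiFoliation,
satisfiable by junk cut families (three refuter verdicts on stmt-10389, 2026-08-15); E (stmt-17336)
is HELD until the predicate is re-typed over definition request D1 — the T2 restatement did not
touch it.

Rationale: WHY THIS LINE. Mechanism (card penrose-deficit-is-a-norm, CAUSALLY REPAIRED here): the null-Penrose
literature (LudvigsenVickers1983, Bergqvist
doi:10.1088/0264-9381/14/9/013, Sauter doi:10.3929/ethz-a-005713669, Mars–Soria arXiv:1511.06242,
Alexakis arXiv:1506.06400 p. 2,
Roesch arXiv:1609.02875 Thm 1.1–1.2, Le arXiv:2404.17137) proves an exact IDENTITY along a foliated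
null hypersurface,
m_H(∞) − m_H(S₀) = ∫Φ with Φ ≥ 0 quadratic in shear, torsion and mass-aspect defect under convexity,
but runs it from a MOTS to
PAST null infinity (future-trapped surfaces are invisible from 𝓘⁺: HawkingEllis1973 Prop. 9.2.1,
arXiv:gr-qc/0001003); the card's
cones "from the MOTT to 𝓘⁺" do not exist. The repair points the identity at i⁺ correctly: take the
LATE outgoing cones, which hug
𝓗⁺ before peeling off to 𝓘⁺, cut them at UNTRAPPED inner spheres just outside 𝓗⁺; the bottom term
m_H(S_u) = √(A/16π)(1 +
(16π)⁻¹∫θ_Lθ_L̲) tends to M_irr(∞) exactly when the cuts hug a quiescent horizon (area law + finite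
final area force θ_L → 0 on
late cuts), the top term is the non-increasing Bondi mass (BondiVanderburgMetzner1962,
ChristodoulouKlainerman1993 Ch. 17), so the
FINAL PENROSE DEFICIT M_B(∞) − M_irr(∞) equals lim_u ∫_(C_u)Φ ≥ 0 — a limit of weighted
L²-cone-norms whose zero set is the
Schwarzschild cones (Roesch's equality case, time-reversed; Sauter Lemma 4.4). Hence equality of TWO
MONOTONE SCALARS at i⁺ is
equivalent to C² convergence to Schwarzschild: quantitative Birkhoff along null cones, no Carleman
estimate, no Łojasiewicz
inequality, no stationary limit. Imported area: quasi-local mass theory / geometric flows (monotone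
Hawking energy as in inverse
mean curvature flow, HuiskenIlmanen2001, here along null foliations), used as a NORM rather than an
inequality. What it adds to the
ledger: TwoBoundarySqueeze and QuietWindowCapture postulate value-coercivity of M_B − 𝔪(A,J) or
observability; here, in the
saturated sector, coercivity is a classical identity and the dichotomy predicate is typed over
existing prelude objects
(FutureBondiFoliation, sectionHawkingMass, totalArea, finalBondiMass); the rotating sector is
isolated as ONE imported node with the
card's Kerr-saturating null mass (K3) and its decisive O(a²) test attached as the way to split it.

RANKED CRUXES. #2 GainFreeConesSettle (crux) — (card K1+K2, equality case; the engine; RESTATED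
2026-08-16 for the re-type T2 as stmt-17336 and HELD pending the re-type of its saturation predicate
over D1 — three refuter verdicts refuted-misstated-on-paper on the predecessor stmt-10389) for every
admissible datum, every MGHD with complete 𝓘⁺ and an event horizon (ray-theoretic: some event
outside the chronological past of every future-complete normalised null ray from the data), every
end e and every canonical future Bondi foliation 𝓕 whose Hawking masses are eventually
non-decreasing outward (s ≥ 0) along the cones, whose inner cuts sec u 0 have areas → A > 0 and
Hawking masses → √(A/16π), and whose final Bondi mass equals √(A/16π): the development settles in
the T2 sense — some O carries a C² final state decomposition d with sub-extremal holes, O =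
exteriorOf d.charted, RaysStayInClosure O, HasExhaustiveCharts d (honest radii), IsFutureOriented d
— and moreover d.N = 1, spin 0, mass = final Bondi mass (Schwarzschild end state). Intended proof:
gain M_B(u) − m_H(sec u 0) → 0 with monotonicity makes the Hawking mass asymptotically constant
along late cones; the null-Penrose identity turns this into weighted-L² smallness of shear, torsion
and mass-aspect defect on every late cone (Roesch Thm 1.1 / Sauter §4, vacuum); the null structure
and Bianchi equations along the cones, which sweep the late domain of outer communications down to
the hugging cuts, upgrade it to C² closeness to Schwarzschild(M_B(∞)) on near-zone and flat slabs
(quantitative Birkhoff along cones, or entry into DHRT characteristic Schwarzschild stability), and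
horizon-normalised charts give exhaustiveness. [difficulty: open-problem] (why it might fail: As
typed the saturation predicate admits junk cut families (stmt-10389: non-round far cuts inflate
bondiMass; spiked/disconnected inner cuts fake hugging) ⇒ false in radiating Schwarzschild-settling
MGHDs until re-typed over D1; T2 adds interior-ray incompleteness; Gain → 0 controls shear/torsion
only in weighted L², L²→C² loss at the horizon end and at infinity.) [arXiv:1609.02875,
doi:10.3929/ethz-a-005713669, arXiv:1506.06400, arXiv210408222, ChristodoulouKlainerman1993,
DafermosHolzegelRodnianskiTaylor2021]
#4 PenroseConesExist (crux) — (card K1, construction / anti-vacuity of the dichotomy) for every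
admissible datum and every MGHD with complete 𝓘⁺ and an event horizon there are an end e and a
canonical future Bondi foliation 𝓕 whose Hawking masses are eventually non-decreasing outward along
the cones and whose inner cuts are SATURATING: areas → A > 0 and Hawking masses → √(A/16π) (i.e. the
cuts hug the quiescent late horizon). No claim on the gain. Intended proof: CK/Bondi–Sachs structure
at complete 𝓘⁺ for the Bondi side; late cones ∂J⁺(ι(B u)) hug 𝓗⁺ (red-shift peeling), carry
doubly-convex (luminosity / constant-mass-aspect, Le) foliations on which the Hawking energy is
monotone; CDGH area law and a final-area bound give θ_L → 0 on late horizon cuts, hence saturating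
untrapped cuts just outside. With FinalPenroseInequality it yields M_B(∞) ≥ M_irr(∞). [difficulty:
open-problem] (why it might fail: Complete 𝓘⁺ (sojourn form) gives no Bondi structure for large data
(Hawking-mass limits, mass loss); Hawking-monotone foliations need trχ > 0 > trχ̲ on whole late
cones, known only near Schwarzschild (Sauter; Le arXiv:2111.02993); hugging cuts need an eventually
smooth 𝓗⁺ with bounded θ̲.) [ChristodoulouKlainerman1993, arXiv:2111.02993, arXiv:1511.06242,
arXiv:gr-qc/0001003, HawkingEllis1973, DafermosRodnianski2009]
#5 UnsaturatedSectorSettles (crux) — (imported; the complementary sector, carrying all the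
genericity; RESTATED 2026-08-16 for the re-type T2 as stmt-17337) for every data manifold X,
TAME-Christodoulou-generically in the admissible class (IsTameChristodoulouGeneric … 1): every MGHD
has complete 𝓘⁺, and IF it has an event horizon and is NOT finally Penrose-saturated (no canonical
future Bondi foliation with monotone late cones, saturating inner cuts and final Bondi mass =
√(A/16π)), it settles in the T2 sense: some O carries a C² final state decomposition with
sub-extremal holes, O = exteriorOf d.charted, RaysStayInClosure O, HasExhaustiveCharts d (honest
radii), IsFutureOriented d. This is tame-generic weak cosmic censorship plus the final state on the
rotating-or-several-holes sector (the generic one); the line's only contribution to it is K3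
(KerrSaturatingConeMass, informal rank 3), whose landing was to split this node into 'censored +
horizon ⇒ K-saturated' → 'K-saturated ⇒ settles to Kerr' (K3's candidate was refuted-substantive
2026-08-15). [difficulty: open-problem] (why it might fail: It is tame-generic WCC plus the Kerr(a ≠
0)/multi-hole final state on the generic sector, for which this line offers only K3; naked
singularities or a non-Kerr ω-limit from an open set of data, or failure of Kerr stability for some
|a| < M, refute it.) [DafermosLuk2017, Christodoulou1999, KlainermanSzeftel2023,
GiorgiKlainermanSzeftel2022, DafermosHolzegelRodnianskiTaylor2021, RodnianskiShlapentokhRothman2023]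
#6 CensoredHorizonlessDisperseT2 (crux) — (imported, shared with route BondiDrainDispersal as
stmt-17284; replaces the pre-T2 CensoredHorizonlessDisperse stmt-9921, dropped here 2026-08-16) for
every admissible datum and every MGHD with complete 𝓘⁺ and NO event horizon in the ray-theoretic
sense, there are O and a C² final state decomposition d with d.N = 0, O = exteriorOf d.charted,
RaysStayInClosure O, exhaustive charts and future-oriented chart time (the N = 0 conclusion of the
re-typed Statement, verbatim). [difficulty: open-problem] (why it might fail: ∀-data claim: an
eternal horizonless vacuum breather with complete 𝓘⁺ and final Bondi mass M_∞ > 0 refutes it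
(no-soliton theorems cover only stationary/time-periodic vacuum: Anderson2000, BicakScholtzTod2010,
AlexakisSchlue2018); or a complete null ray from X outside closure(J⁺Σ ∩ I⁻(flat chart)).)
[AlexakisSchlue2018, BicakScholtzTod2010, Anderson2000, Christodoulou1991, DongSong2024, LukOh2022]
#9 MGHDExists (crux, last-ranked; the summit's shared item stmt-9937, support at open, RE-BADGED
support→crux 2026-08-16 under the crux-only deciding-theorem rule glue.non-crux-hypothesis — exactly
as TwoBoundarySqueeze, MergerLatticeBudget, SettleThenCensor, NoVacuumStrings, GlobalAttraction and
ProbeNullTrace badge the same item) — every admissible vacuum datum has a maximal vacuum Cauchy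
development over the repaired structure VacuumCauchyDevelopment / IsMaximal (Choquet-Bruhat–Geroch
1969 Thm 3; Sbierski 2016 Thm 2.8; Ringström 2009 Thm 16.6). It is VERBATIM the named fact
Literature.Geometry.Lorentzian.choquetBruhat_geroch_exists_mghd_cauchy restricted to
admissibleVacuumData (conditional closure `exact h.forall_mem_admissibleVacuumData`,
AdmissibleMGHDExistence.lean, checked by grounders g16-1 / g17-4 on the item) and supplies exactly
the Statement's anti-vacuity conjunct ∃ 𝒟, 𝒟.IsMaximal inside `closes`; it cannot be a proved lemma
of the glue while the fact is undischarged (XL formalisation in progress on stmt-9937: second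
countability, chain union, domain of dependence and global hyperbolicity bricks landed 2026-08-16).
[difficulty: XL] (why it might fail: known in print but unproved in tree and typing-exposed —
IsMaximal asks EVERY VacuumCauchyDevelopment.{0} of D to embed ι-compatibly into one 𝒟, so a rogue
typed development would falsify it, as the first rendering over the uninhabited VacuumDevelopment
(VacuumDevelopment.isEmpty) was refuted by vacuity.) [ChoquetBruhatGeroch1969CMP, Sbierski2016AHP,
Ringstrom2009, Literature.Geometry.Lorentzian.choquetBruhat_geroch_exists_mghd_cauchy,
Literature.Geometry.Lorentzian.choquetBruhat_geroch_exists_mghd_cauchy.forall_mem_admissibleVacuumData]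
#9 ChristodoulouRuffiniIdentity (support) — (card K3 endpoint consistency, provable now) for 0 < M
and |a| ≤ M, with r₊ = M + √(M² − a²) and M_irr² := M r₊/2: M² = M_irr² + (aM)²/(4 M_irr²) — the
Christodoulou–Ruffini mass formula on the Kerr family, i.e. the candidate Kerr-saturating mass
equals M on every Kerr horizon section. [difficulty: provable-now] [doi:10.1103/PhysRevD.4.3552,
Wald1984]
#9 FinalPenroseInequality (support) — (card P1 squeeze, provable now from the hypothesis structure)
for any Cauchy development, end e and canonical future Bondi foliation whose Hawking masses are
eventually non-decreasing outward along the cones: if the inner Hawking masses m_H(sec u 0) converge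
to m as u → ∞ then m ≤ final Bondi mass. With saturating inner cuts (m = √(A/16π)) this is the final
Penrose inequality M_B(∞) ≥ M_irr(∞); pure filter/real analysis over IsCanonical (hasBondiMass,
antitone, nonneg). [difficulty: provable-now] [Penrose1973, Mars2009, ChristodoulouKlainerman1993]

TWO-LAYER PLAN. Foreseen glued splits (none filed now; k ≤ 3, depth 1). R ⇐ KSaturationDynamics →
KSaturatedConesSettle → R once K3
(KerrSaturatingConeMass) and the definition requests D1/D2 land: KSaturationDynamics = censored +
horizon ⇒ Penrose cones exist and the
K-gain M_B(u) − 𝔪_K(sec u 0) → 0 (card K4: no energy parked outside; dissipation budget + area law +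
𝔪_K-monotonicity);
KSaturatedConesSettle = K-gain → 0 ⇒ settles to Kerr(M_B(∞), J_∞/M_B(∞)) (the rotating twin of E,
equality case of a null Penrose
inequality with angular momentum). E ⇐ ConeNormSmall (gain → 0 ⇒ weighted-L² smallness of
shear/torsion/mass-aspect defect on late
cones, the identity) → ConeToChart (cone-norm small on all late cones ⇒ C² exhaustive Schwarzschild
charts, quantitative Birkhoff) → E.
K1 ⇐ BondiStructureAtCompleteScri → LateConesConvexAndHugging → K1.

KILL CRITERIA. A censored vacuum black-hole development, finally Penrose-saturated in the typed
sense, whose exterior does not converge in C² to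
Schwarzschild refutes E (close `refuted:GainFreeConesSettle`): the deficit would not measure. A
proof that no censored black-hole
development admits Penrose cones with saturating cuts (¬PenroseConesExist, e.g. Hawking-mass limits
along late cones fail to exist
for large data) makes E vacuous and the dichotomy empty — retire `superseded` in favour of
TwoBoundarySqueeze. P2 negative (K3's
candidate not constant to O(a²) on Kerr cones for the luminosity AND affine foliations) kills only
the rotating extension: R then stays
an honest import and the route is downgraded to the Schwarzschild-sector certificate; if in addition
E is judged a corollary of DHRT
alone, close `superseded`. R or H refuted (naked singularities / eternal breathers from open data)
refutes the Statement as typed for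
every route. E ∧ K1 proved elsewhere (e.g. by a quiet-window capture) moots the engine; items are
shared by signature.

NOT DECOMPOSED YET. PENDING RE-TYPE FIRST (not a decomposition): clauses (i)–(iii) of the saturation
predicate shared by E (hypothesis), K1 (conclusion) and R (negated hypothesis) must be re-typed over
definition request D1 (refuters' C′ on stmt-10389: connected surf, affine/luminosity leaves,
asymptotically round far leaves, pointwise hugging sup|θ_L θ_L̲| → 0 on the inner leaf; better,
cones from an optical function instead of data-anchored ∂J⁺(ι(B u)), which are never late when ι(X)
⊂ DOC) — one route edit restating all three together, with `closes` unchanged in shape. The flux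
density Φ and the luminosity / constant-mass-aspect foliation (definition request D1) — until it
lands, "gain → 0 ⇒ cone
norm → 0" lives inside E; the quasi-local angular momentum J(S, φ) and approximate Killing fields on
cuts (D2) — K3 stays informal; the
Bondi structure at complete 𝓘⁺ for large data (shared want of
TwoBoundarySqueeze/MergerLatticeBudget: Bondi mass over CauchyDevelopment
is a hypothesis structure, IsCanonical); the horizon-normalised chart construction behind
HasExhaustiveCharts; the red-shift peeling
lemma placing late cones near 𝓗⁺; the N ≥ 2 and a ≠ 0 sectors (inside R by design); P3 of the card
(J_ADM = 0 for axisymmetric vacuum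
data on ℝ³) — no typed ADM angular momentum yet.

CHEAPEST FALSIFIER. (1) Typing/vacuity check a refuter can run in Lean now: FinalPenroseInequality
and ChristodoulouRuffiniIdentity must be PROVABLE from
the prelude (if FinalPenroseInequality fails, the hypothesis structure IsCanonical does not say what
the route assumes and E/K1 are
mis-typed). (2) The card's P2, a few CPU-hours of computer algebra: on Kerr to O(a²) (Hartle–Thorne
form), along the quasi-spherical
outgoing light cones (Pretorius–Israel gr-qc/9803080) with luminosity and with affine foliations, is
m_H(S_r)² + 4πa²M²/|S_r| ≡ M² +
O(a⁴)? A 'no' for both foliations kills K3's candidate and freezes R as a pure import. Not run here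
(hub compute-free; planner files it
as K3's falsifier). (3) Literature check done: every null-Penrose paper found (1506.06400 p. 2,
1609.02875 Thm 1.2, 1511.06242,
2404.17137) runs the cone to PAST null infinity — confirming the causal repair is necessary and that
the i⁺-directed identity with
untrapped hugging cuts is not in print.

NUMBERS. Christodoulou–Ruffini: M² = M_irr² + J²/4M_irr², so the Kerr window is M_irr ≤ M ≤ √2·M_irr
and the rotating floor M − M_irr ≤ (1 −
1/√2)M ≈ 0.293 M (doi:10.1103/PhysRevD.4.3552). Hawking energy of any cut of a Minkowski light cone
= 0; of any cut of a Schwarzschild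
standard cone ≥ M with equality iff time-symmetric (Sauter Lemma 4.4, quoted in 1609.02875 p. 4) —
the roundness gap K1 must control.
For round cuts of Schwarzschild cones (16π)⁻¹∫θθ̲ dA = −(1 − 2M/r): saturating cuts ⇔ r → 2M.
Nonlinear stability inputs available to
E's last step: Schwarzschild, codimension-3 data (DafermosHolzegelRodnianskiTaylor2021); |a| ≪ M
(KlainermanSzeftel2023). Items at open:
9 (4 typed cruxes, 3 support, 1 assembly; +1 informal crux K3 filed after open); after the
2026-08-16 re-type (rev 5) and re-badge: 6 cruxes (typed ranks 2, 4, 5, 6 and 9 = MGHDExists, + K3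
informal rank 3), 2 supports, 1 assembly — within the 2–7 crux cap; `closes` assumes the four cruxes
E, R, H, S only. Cone (route-repair g1, 2026-08-15, `#h21_route_deps` on the rev-0 file + ledger
deps v1): 173 project constants down to Mathlib, 0 unproved
named facts (the only closed prop_defs are the Statement and this route's 8 items), 0 sorry, 0
non-whitelisted axioms; needs-fact: none.
`PseudoRiemannianMetric.HasLeviCivita` and `CovariantDerivative.CurvatureTensorialAt` enter only as
binder-carrying hypotheses / junk-valued
vocabulary, and already through the Statement's own `admissibleVacuumData` (`∀
[D.metric.HasLeviCivita]`) and `VacuumCauchyDevelopment.mk →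
IsRicciFlat → ricci → curvature`; their closed forms `isCovariantDerivativeOn_leviCivitaFun`,
`curvatureTensorialAt_of_isLocallyContMDiff` are
consumed by no item; `PseudoRiemannianMetric.contMDiff_restrict` and Volume's
`riemannianVolume_lt_top_of_isCompact` /
`riemannianMeasure_eq_integral_sqrt_det` (module-level riders of RadiatedEnergy → BondiMass →
Volume) are reached by no item nor by `closes`.
The one non-boilerplate import, RadiatedEnergy, is load-bearing (FutureBondiFoliation,
sectionHawkingMass, finalBondiMass, IsCanonical e D type
4 items and the case split of `closes`); nothing to drop. Evidence: cone-analysis.md on the route.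

DEFINITION REQUESTS. D1 (topic Literature/Geometry/Lorentzian, for GainFreeConesSettle and K3):
`NullHypersurface.hawkingFlux` — for a null hypersurface
foliated by spacelike 2-spheres with null normal pair (L, L̲): shear χ̂, torsion ζ, mass aspect μ of
the leaves and the flux density Φ
with d m_H/ds = ∫Φ (Sauter §4; Roesch arXiv:1609.02875 Thm 1.1), Φ ≥ 0 under double convexity and
NEC; plus the luminosity /
constant-mass-aspect foliation (Le arXiv:2404.17137). D2 (same topic, for K3):
`Surface.quasiLocalAngularMomentum` — J(S, φ) =
(8π)⁻¹∮_S ζ(φ) dA for φ tangent to S (equals KomarIntegral.komarIntegral for an axial Killing φ),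
and 'approximate Killing field on a
2-sphere' (Cook–Whiting arXiv:0706.0199). Cite-fact wanted (family gr): Hawking-energy monotonicity
along doubly-convex null foliations
in NEC spacetimes (Roesch Thm 1.1; Mars–Soria arXiv:1511.06242 Thm 1), stated over D1.

Novelty: Searches (2026-08-15): `lit search --source zbmath "Penrose inequality null hypersurface Bondi"` (4:
Mars–Soria 2016, Le PAMQ 2024
doi:10.4310/pamq.2024.v20.n4.a6, Bergqvist 1997, Alexakis 1506.06400); `… "Hawking mass null cone
monotonicity"` (2, LeFloch–Mena,
spherical matter); `… "null Penrose inequality angular momentum Kerr"` (1, unrelated preface); `…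
"Penrose inequality event horizon
final state Kerr saturation"` (0); `lit search --source arxiv "quasi-local mass monotone null
hypersurface Kerr rigidity"` (0), `"Le
Pengyu null Penrose …"` (1: arXiv:2404.17137); `lit galaxy search "null Penrose" --star all` (1 pdf:
Le arXiv:2111.02993), `"Hawking
mass" --star pdf` (8, none on late cones / final state), `"Penrose inequality null hypersurface
Bondi mass" --star all` (0); `lit
frontier FinalStateConjecture --since 2021` (30 rows; none on quasi-local mass along late cones);
`lit search --hybrid` unavailable
(searchd rc 75); `lit read` of 1506.06400 pp. 1–3, 1609.02875 pp. 1–4, 2404.17137 pp. 1–3; the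
card's own searches and its unit-6 audit.
Nearest prior art found: arXiv:1609.02875 (Roesch: monotone mass along doubly-convex null
foliations, null Penrose inequality AND its
equality case = Schwarzschild cone data — at past null infinity); arXiv:1506.06400,
doi:10.4310/pamq.2024.v20.n4.a6 / arXiv:2111.02993
(Alexakis, Le: perturbative null Penrose near Schwarzschild, regular null hypersurfaces foliating a
perturbed Schwarzschild exterior);
in spherical symmetry the Hawking-mas  [refs: 10.4310/pamq.2024.v20.n4.a6, 2404.17137, 2111.02993, 1609.02875, 1506.06400, doi:10.4310/pamq.2024.v20.n4.a6, Christodoulou1991]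

Barriers (technique_class: quasi-local-mass-monotonicity, null-cone-identity): - technique_class: quasi-local-mass-monotonicity, null-cone-identity
- Literature.Barriers.FinalStateConjecture.IonescuKlainermanNonExtension: evaded in the saturated
sector — no Killing field is produced or extended, no stationary limit taken: Schwarzschild is
identified as the zero set of a cone identity (quantitative Birkhoff along null hypersurfaces,
insensitive to analyticity); in the unsaturated sector it is not engaged by this line (R is
imported; K3 would make Kerr an equality case too).
- Literature.Barriers.FinalStateConjecture.KerrSuperradiance: no Killing energy anywhere; the three
sign-definite inputs (Bondi mass loss, area law, Hawking-energy monotonicity under convexity) hold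
for all spins — the ergoregion only makes the floor M − M_irr positive, which is exactly the
dichotomy.
- Literature.Barriers.FinalStateConjecture.SbierskiTrappingObstruction: no integrated local energy
decay or rate is claimed; E converts smallness of a limit, not a decay rate; cones cross the photon
sphere transversally and the derivative loss is conceded inside E's why-fail.
- Literature.Barriers.FinalStateConjecture.PriceLawTail: consistent — the deficit is rate-free;
nothing exponential is asserted.
- Literature.Barriers.FinalStateConjecture.AretakisInstability: E's end state is Schwarzschild (no
extremal member); R is stated with sub-extremal conclusion only generically, as the Statement
itself.
- Literature.Barriers.FinalStateConjecture.KehrbergerLogarithmicAsymptotics: only the rad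

History (route lifecycle, newest last):
- 2026-08-16T23:16:21Z · rev 5: restated GainFreeConesSettle (stmt-FinalStateConjecture-10389), UnsaturatedSectorSettles (stmt-FinalStateConjecture-10391), Assembly (stmt-FinalStateConjecture-10394) — route-repair (statement re-typed T2, p126844 2026-08-16T21:19Z): closes re-elaborated. GainFreeConesSettle and UnsaturatedSectorSettles restated (planner-rrepair-FinalStateConjecture-PenroseDe-06b91cc2-0)
- 2026-08-16T23:16:21Z · rev 5: dropped CensoredHorizonlessDisperse — route-repair (statement re-typed T2, p126844 2026-08-16T21:19Z): closes re-elaborated. GainFreeConesSettle and UnsaturatedSectorSettles restated 1:1 with the T2 (planner-rrepair-FinalStateConjecture-PenroseDe-06b91cc2-0)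
- 2026-08-24T16:54:10Z · DORMANT — reconciler: no traction for 6.9 d (last activity statement-grounded at 2026-08-17T18:24:59Z); parked, not closed — `ledger route dormant route-FinalStateConject (operator:999:1345090)
- 2026-08-30T15:49:26Z · REACTIVATED (open) — reconciler: reactivated — activity statement-checked at 2026-08-30T15:06:32Z after parking at 2026-08-24T16:54:10Z (operator:999:2048263)
- 2026-09-04T16:54:25Z · DORMANT — reconciler: no traction for 5 d (last activity statement-checked at 2026-08-30T15:54:01Z); parked, not closed — `ledger route dormant route-FinalStateConjecture (operator:999:1111869)

sub-problem: FinalStateConjecture · status: dormant · opened planner-plancard-FinalStateConjecture-FinalSt-d9e8e805-0 2026-08-15T16:14:04Z · rev 12 · ledger route-FinalStateConjecture-PenroseDeficitNorm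
GENERATED by the gate from the ledger (D-0016/17). Provers cite these decls: `theorem foo : Summit.FinalStateConjecture.FinalStateConjecture.Theses.PenroseDeficitNorm.<Decl> := …` in Summits/FinalStateConjecture/FinalStateConjecture/Theorems/<Name>.lean.
-/

namespace Summit.FinalStateConjecture.FinalStateConjecture.Theses.PenroseDeficitNorm

open scoped BigOperators Topology Manifold Classical MeasureTheory ProbabilityTheory Matrix InnerProductSpace ComplexConjugate ContinuousMap
open Filter Set Function TopologicalSpace MeasureTheory

attribute [summit_statement] _root_.FinalStateConjecture

-- earlier GainFreeConesSettle (stmt-FinalStateConjecture-10389, replaced 2026-08-16T23:16:21Z -> stmt-FinalStateConjecture-17336): retired by None — open Literature.Geometry.Lorentzian in ∀ (X : Type) [TopologicalSpace X] [ChartedSpace E3 X] [IsManifold (𝓡 3) ((⊤ : ℕ∞) : WithTop ℕ∞) X] [T2Space X] [SecondCountableTopology X] [ConnectedSpace X], ∀ D ∈ admissibleVacuumData X, ∀ 𝒟 : VacuumCauchyDevelop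
/-- item stmt-FinalStateConjecture-17336 · crux · rank 2 · open · by planner
why it might fail: As typed the saturation predicate admits junk cut families (stmt-10389: non-round far cuts inflate bondiMass; spiked/disconnected inner cuts fake hugging) ⇒ false in radiating Schwarzschild-settling MGHDs until re-typed over D1; T2 adds interior-ray incompleteness; L²→C² loss.
sources: arXiv:1609.02875, arXiv:2304.08455, doi:10.3929/ethz-a-005713669, arXiv:1506.06400, arXiv210408222, ChristodoulouKlainerman1993
[crux] (card K1+K2, equality case; the engine — RESTATED 2026-08-16 for the summit re-type T2,
p126844: conclusion now in the T2 shape) for every admissible datum, every MGHD with complete 𝓘⁺ and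
an event horizon (ray-theoretic: some event outside the chronological past of every future-complete
normalised null ray from the data), every end e and every canonical future Bondi foliation 𝓕 whose
Hawking masses are eventually non-decreasing outward (s ≥ 0) along the cones, whose inner cuts sec u
0 have areas → A > 0 and Hawking masses → √(A/16π), and whose final Bondi mass equals √(A/16π): the
development settles in the T2 sense — some O carries a C² final state decomposition d with
sub-extremal holes, O = exteriorOf d.charted, every future-complete normalised null ray from the
data stays in closure O (RaysStayInClosure), the charts exhaust O with honest growing near-zone
radii (HasExhaustiveCharts) and chart times are future-oriented (IsFutureOriented) — and moreover
d.N = 1, spin 0, mass = final Bondi mass (Schwarzschild end state). Intended proof as before: gain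
M_B(u) − m_H(sec u 0) → 0 with monotonicity ⇒ weighted-L² smallness of shear/torsion/mass-aspect
defect on late cones (null -/
@[route_item "route-FinalStateConjecture-PenroseDeficitNorm"]
def GainFreeConesSettle : Prop :=
  open Literature.Geometry.Lorentzian in ∀ (X : Type) [TopologicalSpace X] [ChartedSpace E3 X] [IsManifold (𝓡 3) ((⊤ : ℕ∞) : WithTop ℕ∞) X] [T2Space X] [SecondCountableTopology X] [ConnectedSpace X], ∀ D ∈ admissibleVacuumData X, ∀ 𝒟 : VacuumCauchyDevelopment D, 𝒟.IsMaximal → Summit.FinalStateConjecture.HasCompleteNullInfinity 𝒟.toCauchyDevelopment → (∀ [𝒟.metric.HasLeviCivita], ∃ q : 𝒟.carrier, ∀ (p : X) (γ : ℝ → 𝒟.carrier) (dom : Set ℝ), 𝒟.metric.IsNormalisedNullRayFrom 𝒟.timeOrientation 𝒟.embed 𝒟.normal p γ dom → ¬ BddAbove dom → q ∉ 𝒟.metric.chronologicalPast 𝒟.timeOrientation (γ '' (dom ∩ Set.Ici 0))) → ∀ (e : AFEnd X) (𝓕 : 𝒟.toCauchyDevelopment.FutureBondiFoliation), 𝓕.IsCanonical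 e D → (∀ᶠ u in atTop, MonotoneOn (𝓕.sectionHawkingMass u) (Set.Ici 0)) → ∀ A : ℝ, 0 < A → Tendsto (fun u ↦ (totalArea (𝒟.metric.inducedRiemannianMetric (𝓕.sec u 0) 𝓕.hpb (𝓕.isSpacelike u 0))).toReal) atTop (𝓝 A) → Tendsto (fun u ↦ 𝓕.sectionHawkingMass u 0) atTop (𝓝 (Real.sqrt (A / (16 * Real.pi)))) → 𝓕.finalBondiMass = Real.sqrt (A / (16 * Real.pi)) → ∃ (O : Set 𝒟.carrier) (d : FinalStateDecomposition 𝒟.toSpacetime O 2), (∀ i, Kerr.IsSubextremal (d.mass i) (d.spin i)) ∧ O = Summit.FinalStateConjecture.exteriorOf 𝒟.toCauchyDevelopment d.charted ∧ Summit.FinalStateConjecture.RaysStayInClosure 𝒟.toCauchyDevelopment O ∧ Summit.FinalStateConjecture.HasExhaustiveCharts d ∧ Summit.FinalStateConjecture.IsFutureOriented d ∧ d.N = 1 ∧ ∀ i, d.spin i = 0 ∧ d.mass i = 𝓕.finalBondiMass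

-- item stmt-FinalStateConjecture-10431 · crux · rank 3 · open · by planner — informal only, no Lean statement yet:
--   [crux] KerrSaturatingConeMass (card penrose-deficit-is-a-norm K3; the missing object for the
--   rotating sector, whose landing splits UnsaturatedSectorSettles into 'censored + horizon ⇒
--   K-saturated cones' → 'K-saturated cones settle to Kerr'). There is an EXPLICIT 2-surface functional
--   𝔪_K(S; φ) = F(m_H(S), |S|, J(S, φ)) — candidate 𝔪_K² = m_H² + 4π J²/|S| — where m_H is the Hawking
--   energy, |S| the area and J(S, φ) = (8π)⁻¹∮_S ζ(φ) dA the quasi-local angular momentum of a rotation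
--   field φ tangent to S (definition request D2), such that: (a) on Kerr(M, a), 0 < |a| < M, with φ the
--   axial Killing fiel

/-- item stmt-FinalStateConjecture-10390 · crux · rank 4 · open · by planner
why it might fail: Needs a genuine IsCanonical foliation for LARGE censored data (m_H limits on every cone, mass loss, M_B → E_ADM as u → −∞: CK-strength asymptotics, known only perturbatively); m_H-monotone cone foliations known only near Schwarzschild (Sauter §4, Le 2111.02993); hugging cuts need θ_L → 0 on late 𝓗⁺.
sources: ChristodoulouKlainerman1993, arXiv:2111.02993, arXiv:2404.17137, arXiv:1511.06242, arXiv:gr-qc/0001003, HawkingEllis1973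
[crux] (card K1, construction / anti-vacuity of the dichotomy) for every admissible datum and every
MGHD with complete 𝓘⁺ and an event horizon there are an end e and a canonical future Bondi foliation
𝓕 whose Hawking masses are eventually non-decreasing outward along the cones and whose inner cuts
are SATURATING: areas → A > 0 and Hawking masses → √(A/16π) (i.e. the cuts hug the quiescent late
horizon). No claim on the gain. Intended proof: CK/Bondi–Sachs structure at complete 𝓘⁺ for the
Bondi side; late cones ∂J⁺(ι(B u)) hug 𝓗⁺ (red-shift peeling), carry doubly-convex (luminosity /
constant-mass-aspect, Le) foliations on which the Hawking energy is monotone; CDGH area law and a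
final-area bound give θ_L → 0 on late horizon cuts, hence saturating untrapped cuts just outside.
With FinalPenroseInequality it yields M_B(∞) ≥ M_irr(∞). [difficulty: open-problem] -/
@[route_item "route-FinalStateConjecture-PenroseDeficitNorm"]
def PenroseConesExist : Prop :=
  open Literature.Geometry.Lorentzian in ∀ (X : Type) [TopologicalSpace X] [ChartedSpace E3 X] [IsManifold (𝓡 3) ((⊤ : ℕ∞) : WithTop ℕ∞) X] [T2Space X] [SecondCountableTopology X] [ConnectedSpace X], ∀ D ∈ admissibleVacuumData X, ∀ 𝒟 : VacuumCauchyDevelopment D, 𝒟.IsMaximal → Summit.FinalStateConjecture.HasCompleteNullInfinity 𝒟.toCauchyDevelopment → (∀ [𝒟.metric.HasLeviCivita], ∃ q : 𝒟.carrier, ∀ (p : X) (γ : ℝ → 𝒟.carrier) (dom : Set ℝ), 𝒟.metric.IsNormalisedNullRayFrom 𝒟.timeOrientation 𝒟.embed 𝒟.normal p γ dom → ¬ BddAbove dom → q ∉ 𝒟.metric.chronologicalPast 𝒟.timeOrientation (γ '' (dom ∩ Set.Ici 0))) → ∃ (e : AFEnd X) (𝓕 : 𝒟.toCauchyDevelopment.FutureBondiFoliation),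 𝓕.IsCanonical e D ∧ (∀ᶠ u in atTop, MonotoneOn (𝓕.sectionHawkingMass u) (Set.Ici 0)) ∧ ∃ A : ℝ, 0 < A ∧ Tendsto (fun u ↦ (totalArea (𝒟.metric.inducedRiemannianMetric (𝓕.sec u 0) 𝓕.hpb (𝓕.isSpacelike u 0))).toReal) atTop (𝓝 A) ∧ Tendsto (fun u ↦ 𝓕.sectionHawkingMass u 0) atTop (𝓝 (Real.sqrt (A / (16 * Real.pi))))

-- earlier UnsaturatedSectorSettles (stmt-FinalStateConjecture-10391, replaced 2026-08-16T23:16:21Z -> stmt-FinalStateConjecture-17337): retired by None — open Literature.Geometry.Lorentzian in ∀ (X : Type) [TopologicalSpace X] [ChartedSpace E3 X] [IsManifold (𝓡 3) ((⊤ : ℕ∞) : WithTop ℕ∞) X] [T2Space X] [SecondCountableTopology X] [ConnectedSpace X], InitialDataSet.IsChristodoulouGeneric (admissibleV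
/-- item stmt-FinalStateConjecture-17337 · crux · rank 5 · open · by planner
why it might fail: Tame-generic WCC + the Kerr(a≠0)/multi-hole final state (with oriented honest charts, interior-ray incompleteness) on the generic sector, for which this line offers nothing after K3 fell; naked singularities or a non-Kerr ω-limit from an open data set, or Kerr instability for some |a|<M, refute it.
sources: DafermosLuk2017, Christodoulou1999, KlainermanSzeftel2023, GiorgiKlainermanSzeftel2022, DafermosHolzegelRodnianskiTaylor2021, RodnianskiShlapentokhRothman2023
[crux] (imported; the complementary sector, carrying all the genericity — RESTATED 2026-08-16 for
the summit re-type T2, p126844: tame genericity + T2 conclusion) for every data manifold X,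
TAME-Christodoulou-generically in the admissible class (InitialDataSet.IsTameChristodoulouGeneric …
1: through every exceptional datum an injective one-parameter admissible family on ONE fixed end,
continuous mass, continuous at 0 in the weighted C²₋₁ × C¹₋₂ distance, immersed at 0): every MGHD
has complete 𝓘⁺, and IF it has an event horizon and is NOT finally Penrose-saturated (no canonical
future Bondi foliation with monotone late cones, saturating inner cuts and final Bondi mass =
√(A/16π) — the same predicate as GainFreeConesSettle, negated), it settles in the T2 sense: some O
carries a C² final state decomposition with sub-extremal holes, O = exteriorOf d.charted,
RaysStayInClosure O, HasExhaustiveCharts d (honest radii), IsFutureOriented d. This is tame-generic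
weak cosmic censorship plus the final state on the rotating-or-several-holes sector; the line's only
contribution to it was K3 (KerrSaturatingConeMass, informal rank 3, refuted-substantive as a
candidate 2026-08-15). Caveat inherite -/
@[route_item "route-FinalStateConjecture-PenroseDeficitNorm"]
def UnsaturatedSectorSettles : Prop :=
  open Literature.Geometry.Lorentzian in ∀ (X : Type) [TopologicalSpace X] [ChartedSpace E3 X] [IsManifold (𝓡 3) ((⊤ : ℕ∞) : WithTop ℕ∞) X] [T2Space X] [SecondCountableTopology X] [ConnectedSpace X], InitialDataSet.IsTameChristodoulouGeneric (admissibleVacuumData X) (fun D ↦ ∀ 𝒟 : VacuumCauchyDevelopment D, 𝒟.IsMaximal → Summit.FinalStateConjecture.HasCompleteNullInfinity 𝒟.toCauchyDevelopment ∧ ((∀ [𝒟.metric.HasLeviCivita], ∃ q : 𝒟.carrier, ∀ (p : X) (γ : ℝ → 𝒟.carrier) (dom : Set ℝ), 𝒟.metric.IsNormalisedNullRayFrom 𝒟.timeOrientation 𝒟.embed 𝒟.normal p γ dom → ¬ BddAbove dom → q ∉ 𝒟.metric.chronologicalPast 𝒟.timeOrientation (γ '' (dom ∩ Set.Ici 0)))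 → ¬ (∃ (e : AFEnd X) (𝓕 : 𝒟.toCauchyDevelopment.FutureBondiFoliation), 𝓕.IsCanonical e D ∧ (∀ᶠ u in atTop, MonotoneOn (𝓕.sectionHawkingMass u) (Set.Ici 0)) ∧ ∃ A : ℝ, 0 < A ∧ Tendsto (fun u ↦ (totalArea (𝒟.metric.inducedRiemannianMetric (𝓕.sec u 0) 𝓕.hpb (𝓕.isSpacelike u 0))).toReal) atTop (𝓝 A) ∧ Tendsto (fun u ↦ 𝓕.sectionHawkingMass u 0) atTop (𝓝 (Real.sqrt (A / (16 * Real.pi)))) ∧ 𝓕.finalBondiMass = Real.sqrt (A / (16 * Real.pi))) → ∃ (O : Set 𝒟.carrier) (d : FinalStateDecomposition 𝒟.toSpacetime O 2), (∀ i, Kerr.IsSubextremal (d.mass i) (d.spin i)) ∧ O = Summit.FinalStateConjecture.exteriorOf 𝒟.toCauchyDevelopment d.charted ∧ Summit.FinalStateConjecture.RaysStayInClosure 𝒟.toCauchyDevelopment O ∧ Summit.FinalStateConjecture.HasExhaustiveCharts d ∧ Summit.FinalStateConjecture.IsFutureOriented d)) 1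

/-- item stmt-FinalStateConjecture-17284 · crux · rank 6 · open · by planner
why it might fail: ∀-data claim: an eternal horizonless vacuum breather with complete 𝓘⁺ and M_B(∞) > 0 refutes it (no-soliton theorems cover only stationary/time-periodic vacuum: Anderson2000, BicakScholtzTod2010, AlexakisSchlue2018); T2: so does a complete null ray from X outside closure(J⁺Σ ∩ I⁻(flat chart)).
sources: AlexakisSchlue2018, BicakScholtzTod2010, Anderson2000, Christodoulou1991, DongSong2024, LukOh2022
[crux] CensoredHorizonlessDisperse (rev 3: restated 1:1 after the Statement re-type T2, p126844).
For every admissible datum D (Christodoulou class, Dafermos–Rodnianski fall-off) and every maximal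
vacuum Cauchy development 𝒟 of D: if 𝒟 has complete future null infinity (sojourn form) and NO EVENT
HORIZON in the intrinsic ray-theoretic sense — it is false that some event q lies outside the
chronological past I⁻(γ(dom ∩ [0,∞))) of every future-complete normalised null ray γ from the data
hypersurface — then there are O and a C² final-state decomposition d of O with d.N = 0, O = J⁺(ιX) ∩
I⁻(d.charted) (exteriorOf), every future-complete normalised null ray from X staying in closure O
(RaysStayInClosure), exhaustive charts with honest radii (HasExhaustiveCharts) and future-oriented
chart time (IsFutureOriented) — the N = 0 conclusion of the re-typed Statement, verbatim. Composite
of the card's HorizonlessMustDrain (rank 4) and DrainImpliesDisperse (rank 2); hypothesis of the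
crux-only deciding theorem `closes`. [difficulty: open-problem] -/
@[route_item "route-FinalStateConjecture-PenroseDeficitNorm"]
def CensoredHorizonlessDisperseT2 : Prop :=
  ∀ (X : Type) [TopologicalSpace X] [ChartedSpace Literature.Geometry.Lorentzian.E3 X] [IsManifold (𝓡 3) ((⊤ : ℕ∞) : WithTop ℕ∞) X] [T2Space X] [SecondCountableTopology X] [ConnectedSpace X], ∀ D ∈ Literature.Geometry.Lorentzian.admissibleVacuumData X, ∀ 𝒟 : Literature.Geometry.Lorentzian.VacuumCauchyDevelopment D, 𝒟.IsMaximal → Summit.FinalStateConjecture.HasCompleteNullInfinity 𝒟.toCauchyDevelopment → ¬ (∀ [𝒟.metric.HasLeviCivita], ∃ q : 𝒟.carrier, ∀ (p : X) (γ : ℝ → 𝒟.carrier) (dom : Set ℝ), 𝒟.metric.IsNormalisedNullRayFrom 𝒟.timeOrientation 𝒟.embed 𝒟.normal p γ dom → ¬ BddAbove dom → q ∉ 𝒟.metric.chronologicalPast 𝒟.timeOrientation (γ '' (dom ∩ Set.Ici 0))) → ∃ (O : Set 𝒟.carrier) (d : Literature.Geometry.Lorentzian.FinalStateDecomposition 𝒟.toSpacetime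 O 2), d.N = 0 ∧ O = Summit.FinalStateConjecture.exteriorOf 𝒟.toCauchyDevelopment d.charted ∧ Summit.FinalStateConjecture.RaysStayInClosure 𝒟.toCauchyDevelopment O ∧ Summit.FinalStateConjecture.HasExhaustiveCharts d ∧ Summit.FinalStateConjecture.IsFutureOriented d

/-- item stmt-FinalStateConjecture-9937 · crux · rank 9 · open · by planner
why it might fail: Known in print (CBG 1969 Thm 3; Sbierski 2016) but UNPROVED in tree (= fact choquetBruhat_geroch_exists_mghd_cauchy on admissible data, XL), typing-exposed: IsMaximal asks EVERY VacuumCauchyDevelopment.{0} of D to embed into one 𝒟; a rogue typed development (cf. VacuumDevelopment.isEmpty) kills it.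
sources: ChoquetBruhatGeroch1969CMP, Sbierski2016AHP, Ringstrom2009, Literature.Geometry.Lorentzian.choquetBruhat_geroch_exists_mghd_cauchy, Literature.Geometry.Lorentzian.choquetBruhat_geroch_exists_mghd_cauchy.forall_mem_admissibleVacuumData
[support] every admissible datum has a maximal globally hyperbolic vacuum development, stated over
the repaired structure `VacuumCauchyDevelopment` (the corrected form of the deprecated
`choquetBruhat_geroch_exists_mghd`, recorded in `CauchyProblemExistenceDefect`);
Choquet-Bruhat–Geroch 1969 Thm. 3, Sbierski 2016 Thm. 2.6. Known theorem; large formalisation;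
shared by every route of this summit. [difficulty: XL] -/
@[route_item "route-FinalStateConjecture-PenroseDeficitNorm"]
def MGHDExists : Prop :=
  ∀ (X : Type) [TopologicalSpace X] [ChartedSpace Literature.Geometry.Lorentzian.E3 X] [IsManifold (𝓡 3) ((⊤ : ℕ∞) : WithTop ℕ∞) X] [T2Space X] [SecondCountableTopology X] [ConnectedSpace X], ∀ D ∈ Literature.Geometry.Lorentzian.admissibleVacuumData X, ∃ 𝒟 : Literature.Geometry.Lorentzian.VacuumCauchyDevelopment D, 𝒟.IsMaximal

/-- item stmt-FinalStateConjecture-10392 · support · rank 9 · open · by planner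
sources: doi:10.1103/PhysRevD.4.3552, Wald1984
[support] (card K3 endpoint consistency, provable now) for 0 < M and |a| ≤ M, with r₊ = M + √(M² −
a²) and M_irr² := M r₊/2: M² = M_irr² + (aM)²/(4 M_irr²) — the Christodoulou–Ruffini mass formula on
the Kerr family, i.e. the candidate Kerr-saturating mass equals M on every Kerr horizon section.
[difficulty: provable-now] -/
@[route_item "route-FinalStateConjecture-PenroseDeficitNorm"]
def ChristodoulouRuffiniIdentity : Prop :=
  ∀ M a : ℝ, 0 < M → |a| ≤ M → M ^ 2 = M * Literature.Geometry.Lorentzian.Kerr.rPlus M a / 2 + (a * M) ^ 2 / (4 * (M * Literature.Geometry.Lorentzian.Kerr.rPlus M a / 2))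

/-- item stmt-FinalStateConjecture-10393 · support · rank 9 · open · by planner
sources: Penrose1973, Mars2009, ChristodoulouKlainerman1993
[support] (card P1 squeeze, provable now from the hypothesis structure) for any Cauchy development,
end e and canonical future Bondi foliation whose Hawking masses are eventually non-decreasing
outward along the cones: if the inner Hawking masses m_H(sec u 0) converge to m as u → ∞ then m ≤
final Bondi mass. With saturating inner cuts (m = √(A/16π)) this is the final Penrose inequality
M_B(∞) ≥ M_irr(∞); pure filter/real analysis over IsCanonical (hasBondiMass, antitone, nonneg).
[difficulty: provable-now] -/
@[route_item "route-FinalStateConjecture-PenroseDeficitNorm"]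
def FinalPenroseInequality : Prop :=
  open Literature.Geometry.Lorentzian in ∀ (X : Type) [TopologicalSpace X] [ChartedSpace E3 X] [IsManifold (𝓡 3) ((⊤ : ℕ∞) : WithTop ℕ∞) X] [ConnectedSpace X], ∀ (D : InitialDataSet (𝓡 3) X) (𝒟 : CauchyDevelopment D) (e : AFEnd X) (𝓕 : 𝒟.FutureBondiFoliation), 𝓕.IsCanonical e D → (∀ᶠ u in atTop, MonotoneOn (𝓕.sectionHawkingMass u) (Set.Ici 0)) → ∀ m : ℝ, Tendsto (fun u ↦ 𝓕.sectionHawkingMass u 0) atTop (𝓝 m) → m ≤ 𝓕.finalBondiMass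

-- earlier Assembly (stmt-FinalStateConjecture-10394, replaced 2026-08-16T23:16:21Z -> stmt-FinalStateConjecture-17338): retired by None — GainFreeConesSettle → UnsaturatedSectorSettles → CensoredHorizonlessDisperse → MGHDExists → FinalStateConjecture
/-- item stmt-FinalStateConjecture-17338 · assembly · rank 1 · open · by planner
sources: DafermosLuk2017, Christodoulou1999
[assembly] GainFreeConesSettle → UnsaturatedSectorSettles → CensoredHorizonlessDisperseT2 →
MGHDExists → FinalStateConjecture (the root-level Statement decl, re-typed T2 2026-08-16); proved by
the deciding theorem `closes` (pure logic: tame Christodoulou-genericity is monotone in the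
property; trichotomy no horizon / finally Penrose-saturated / not). -/
@[route_item "route-FinalStateConjecture-PenroseDeficitNorm"]
def Assembly : Prop :=
  GainFreeConesSettle → UnsaturatedSectorSettles → CensoredHorizonlessDisperseT2 → MGHDExists → FinalStateConjecture

/-! D-0027 §2.1 — DECIDING THEOREM (planner-authored via `route open/edit --closes-file`; by planner-rbadge-FinalStateConjecture-PenroseDef-2194eb3c-0 2026-08-16T23:39:53Z):
its hypotheses are this route's items and its conclusion the sub-problem Statement (glue_lint), and it elaborates with this file. -/

@[closes "route-FinalStateConjecture-PenroseDeficitNorm"] theorem closes (h₁ : GainFreeConesSettle) (h₂ : UnsaturatedSectorSettles)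
    (h₃ : CensoredHorizonlessDisperseT2) (h₄ : MGHDExists) : FinalStateConjecture := by
  -- crux-only (2026-08-16): E = h₁, R = h₂, H = h₃, S = h₄ (MGHDExists, re-badged crux) are all crux items
  intro X _ _ _ _ _ _
  -- tame Christodoulou-genericity (codimension 1, curve form, one fixed end) is monotone in the
  -- property: the witnessing end, family, tameness, immersion, base point, injectivity and
  -- admissibility are kept; only the exceptional-set membership is transported.
  have mono : ∀ {P Q : Literature.Geometry.Lorentzian.InitialDataSet (modelWithCornersSelf ℝ (EuclideanSpace ℝ (Fin 3))) X → Prop},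
      Literature.Geometry.Lorentzian.InitialDataSet.IsTameChristodoulouGeneric
          (Literature.Geometry.Lorentzian.admissibleVacuumData X) P 1 →
        (∀ D ∈ Literature.Geometry.Lorentzian.admissibleVacuumData X, P D → Q D) →
          Literature.Geometry.Lorentzian.InitialDataSet.IsTameChristodoulouGeneric
            (Literature.Geometry.Lorentzian.admissibleVacuumData X) Q 1 := by
    intro P Q h hPQ d hd
    obtain ⟨e, F, hF, himm, h0, hinj, hDF, hE⟩ := h d ⟨hd.1, fun hP => hd.2 (hPQ d hd.1 hP)⟩
    exact ⟨e, F, hF, himm, h0, hinj, hDF,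
      fun c hc hc' => hE c hc ⟨hc'.1, fun hP => hc'.2 (hPQ _ hc'.1 hP)⟩⟩
  refine mono (h₂ X) ?_
  intro D hD hP
  refine ⟨h₄ X D hD, fun 𝒟 h𝒟 => ?_⟩
  obtain ⟨hCNI, hrest⟩ := hP 𝒟 h𝒟
  refine ⟨hCNI, ?_⟩
  -- the typed dichotomy: no event horizon (H) / horizon and finally Penrose-saturated (E) /
  -- horizon and not finally Penrose-saturated (R's own clause)
  by_cases hH : (∀ [𝒟.metric.HasLeviCivita], ∃ q : 𝒟.carrier, ∀ (p : X) (γ : ℝ → 𝒟.carrier) (dom : Set ℝ),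
      𝒟.metric.IsNormalisedNullRayFrom 𝒟.timeOrientation 𝒟.embed 𝒟.normal p γ dom →
      ¬ BddAbove dom → q ∉ 𝒟.metric.chronologicalPast 𝒟.timeOrientation (γ '' (dom ∩ Set.Ici 0)))
  · by_cases hSat : (∃ (e : Literature.Geometry.Lorentzian.AFEnd X) (𝓕 : 𝒟.toCauchyDevelopment.FutureBondiFoliation), 𝓕.IsCanonical e D ∧ (∀ᶠ u in atTop, MonotoneOn (𝓕.sectionHawkingMass u) (Set.Ici 0)) ∧ ∃ A : ℝ, 0 < A ∧ Tendsto (fun u ↦ (Literature.Geometry.Lorentzian.totalArea (𝒟.metric.inducedRiemannianMetric (𝓕.sec u 0) 𝓕.hpb (𝓕.isSpacelike u 0))).toReal) atTop (𝓝 A) ∧ Tendsto (fun u ↦ 𝓕.sectionHawkingMass u 0) atTop (𝓝 (Real.sqrt (A / (16 * Real.pi)))) ∧ 𝓕.finalBondiMass = Real.sqrt (A / (16 * Real.pi)))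
    · obtain ⟨e, 𝓕, hc, hmono, A, hA, harea, hmH, hfin⟩ := hSat
      obtain ⟨O, d, hsub, hO, hrays, hex, hfo, -⟩ :=
        h₁ X D hD 𝒟 h𝒟 hCNI hH e 𝓕 hc hmono A hA harea hmH hfin
      exact ⟨O, d, hsub, hO, hrays, hex, hfo⟩
    · exact hrest hH hSat
  · obtain ⟨O, d, hN, hO, hrays, hE, hfo⟩ := h₃ X D hD 𝒟 h𝒟 hCNI hH
    exact ⟨O, d, fun i ↦ (Fin.cast hN i).elim0, hO, hrays, hE, hfo⟩

end Summit.FinalStateConjecture.FinalStateConjecture.Theses.PenroseDeficitNorm
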